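import Mathlib
import HarnessLib
import Literature.MathematicalPhysics.QuantumLattice.GaugeGroups
import Literature.MathematicalPhysics.QuantumFieldTheory.ConstructiveQFTWave0
import Literature.MathematicalPhysics.QuantumFieldTheory.UnitaryCayleyChart
import Literature.MathematicalPhysics.QuantumFieldTheory.CircleHaarAngle
import Literature.MathematicalPhysics.QuantumFieldTheory.Balaban1983to89.T4HaarSUNLocalDiffeo
import Summits.Ventures.LatticeQCDFlow.Scaling.LatticeEntropyU1
import Summits.Ventures.LatticeQCDFlow.Scaling.LatticeEntropyUN
import Summits.Ventures.LatticeQCDFlow.Scaling.LatticeEntropySUNHaar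

/-!
# LatticeQCDFlow / Scaling — Haar volume of the action balls of `SU(N)` is `≍ r^{N²-1}` (R-T2-10 (v), part 2/2)

HONEST FRAMING: exact (Metropolis-corrected) sampling algorithms for lattice gauge theory; figures of merit are
autocorrelation/cost numbers at stated couplings and volumes; no continuum-physics claim.

Venture `LatticeQCDFlow` (cell pub-lqcd), topic `Scaling`, FANOUT row 30 (lean-1) — OUR WORK, sequel of
`Scaling/LatticeEntropySUNHaar.lean` (the splitting `ψ_*(Haar_{U(1)} ⊗ Haar_{SU(N)}) = Haar_{U(N)}`).  PROVED here,
for every `N ≥ 1` and in the literal form of theory-2's items `SUN.HaarActionBallLower N` /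
`SUN.HaarActionBallUpper N`:

* `haar_actionBall_ge`: `∃ a > 0, ∀ 0 < r ≤ 1, a·r^{N²-1} ≤ Haar{V ∈ SU(N) : N - Re tr V ≤ r²}`;
* `haar_actionBall_le`: `∃ A, ∀ r > 0, Haar{V ∈ SU(N) : N - Re tr V ≤ r²} ≤ A·r^{N²-1}`.

Route (§4–§5): the action balls are the Hilbert–Schmidt balls `B^{SU}(1, √2·r)`;
`ψ(arc_t × B^{SU}(1,s)) ⊆ B^{U}(1, t+s)` gives `Haar_{U(1)}(arc_r)·Haar(A_r) ≤ σ(B(1,(1+√2)r)) ≤ A((1+√2)r)^{N²}`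
with `Haar_{U(1)}(arc_r) ≥ r/π`; `ψ⁻¹B^{U}(1,δ) ⊆ {‖z-1‖ ≤ Kδ} × B^{SU}(1,(1+K)δ)` (`K` the Lipschitz constant
of `det`) gives `a·δ^{N²} ≤ σ(B(1,δ)) ≤ (Kδ/2)·Haar(A_r)` with `δ = √2·r/(1+K)`.  With theory-2's
`SUN.entropyGrowthLaw_of_haarActionBalls` these make the `SU(N)` entropy-growth law unconditional (assembled in
a separate file once those items are in the tree).  Elementary; nothing here is cited as a fact.
-/

noncomputable section

open scoped Matrix.Norms.Frobenius ENNReal NNReal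
open MeasureTheory Metric Set Real
open Literature.MathematicalPhysics.QuantumFieldTheory
open Literature.MathematicalPhysics.QuantumFieldTheory.UnitaryCayley (𝔾 gball mem_gball measurableSet_gball
  gball_mono continuous_norm_coe_sub)
open Literature.MathematicalPhysics.QuantumFieldTheory.Balaban1983to89.T4HaarSUNLocalDiffeo (incl coe_incl
  continuous_incl dmat dmat_mem_unitaryGroup det_dmat dmat_mul_dmat dmat_one dmat_eq E₀ E₀_apply
  continuous_dmat detRows detRows_apply)
open Literature.MathematicalPhysics.QuantumLattice (fundamentalRep fundamentalRep_apply unitaryFundamentalRep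
  unitaryFundamentalRep_apply)

namespace Summit.Ventures.LatticeQCDFlow.Theory2.Lattice.SUNHaar

variable {N : ℕ}

/-! ## §4. Action balls of `SU(N)` and the two inclusions -/

section Balls

/-- `N - Re tr V = ‖V - 1‖²_F / 2` on `SU(N)`. [folklore] -/
theorem action_eq (V : Matrix.specialUnitaryGroup (Fin N) ℂ) :
    (N : ℝ) - (fundamentalRep (Fin N) V).trace.re = ‖(V : Matrix (Fin N) (Fin N) ℂ) - 1‖ ^ 2 / 2 := by
  have h := UN.action_eq (incl V)
  rw [unitaryFundamentalRep_apply, coe_incl] at h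
  rw [fundamentalRep_apply]; exact h

/-- The action is continuous on `SU(N)`. [folklore] -/
theorem continuous_action :
    Continuous fun V : Matrix.specialUnitaryGroup (Fin N) ℂ => (N : ℝ) - (fundamentalRep (Fin N) V).trace.re := by
  have h : Continuous fun V : Matrix.specialUnitaryGroup (Fin N) ℂ =>
      ‖(V : Matrix (Fin N) (Fin N) ℂ) - 1‖ ^ 2 / 2 :=
    (((continuous_subtype_val : Continuous fun V : Matrix.specialUnitaryGroup (Fin N) ℂ =>
      (V : Matrix (Fin N) (Fin N) ℂ)).sub continuous_const).norm.pow 2).div_const 2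
  exact h.congr fun V => (action_eq V).symm

/-- Action balls of `SU(N)` are measurable. [folklore] -/
theorem measurableSet_actionBall (t : ℝ) :
    MeasurableSet
      {V : Matrix.specialUnitaryGroup (Fin N) ℂ | (N : ℝ) - (fundamentalRep (Fin N) V).trace.re ≤ t} :=
  (isClosed_le continuous_action continuous_const).measurableSet

/-- **Action balls are Hilbert–Schmidt balls**: `{N - Re tr V ≤ r²} = {‖V - 1‖ ≤ √2·r}` (`r ≥ 0`).
[folklore] -/
theorem actionBall_eq {r : ℝ} (hr : 0 ≤ r) :
    {V : Matrix.specialUnitaryGroup (Fin N) ℂ | (N : ℝ) - (fundamentalRep (Fin N) V).trace.re ≤ r ^ 2} =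
      {V : Matrix.specialUnitaryGroup (Fin N) ℂ |
        ‖(V : Matrix (Fin N) (Fin N) ℂ) - 1‖ ≤ Real.sqrt 2 * r} := by
  ext V
  rw [mem_setOf_eq, mem_setOf_eq, action_eq]
  have h0 := norm_nonneg ((V : Matrix (Fin N) (Fin N) ℂ) - 1)
  have h2 : (Real.sqrt 2 * r) ^ 2 = 2 * r ^ 2 := by rw [mul_pow, Real.sq_sqrt (by norm_num)]
  constructor
  · intro h
    have h3 : ‖(V : Matrix (Fin N) (Fin N) ℂ) - 1‖ ^ 2 ≤ (Real.sqrt 2 * r) ^ 2 := by rw [h2]; linarith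
    exact le_of_pow_le_pow_left₀ two_ne_zero (by positivity) h3
  · intro h
    have h3 := pow_le_pow_left₀ h0 h 2
    rw [h2] at h3
    linarith

variable [NeZero N]

/-- **Upper inclusion**: `ψ(arc_t × B^{SU}(1,s)) ⊆ B^{U}(1, t + s)`. [folklore] -/
theorem psi_mem_gball {t s : ℝ} {z : Circle} (hz : z ∈ U1.arc t) {V : Matrix.specialUnitaryGroup (Fin N) ℂ}
    (hV : ‖(V : Matrix (Fin N) (Fin N) ℂ) - 1‖ ≤ s) : psi (z, V) ∈ gball N (t + s) := by
  rw [mem_gball, coe_psi]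
  have e : dmat (z : ℂ) * (V : Matrix (Fin N) (Fin N) ℂ) - 1 =
      ((dC z : 𝔾 N) : Matrix (Fin N) (Fin N) ℂ) * ((V : Matrix (Fin N) (Fin N) ℂ) - 1) +
        (((dC z : 𝔾 N) : Matrix (Fin N) (Fin N) ℂ) - 1) := by
    rw [coe_dC, Matrix.mul_sub, Matrix.mul_one]; abel
  rw [e]
  calc _ ≤ ‖((dC z : 𝔾 N) : Matrix (Fin N) (Fin N) ℂ) * ((V : Matrix (Fin N) (Fin N) ℂ) - 1)‖ +
        ‖((dC z : 𝔾 N) : Matrix (Fin N) (Fin N) ℂ) - 1‖ := norm_add_le _ _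
    _ = ‖(V : Matrix (Fin N) (Fin N) ℂ) - 1‖ + ‖(z : ℂ) - 1‖ := by
        rw [Matrix.frobenius_norm_unitaryGroup_mul, norm_coe_dC_sub_one]
    _ ≤ s + t := add_le_add hV (norm_sub_one_le_of_mem_arc hz)
    _ = t + s := add_comm _ _

/-- **Lower inclusion**: if `ψ(z, V) ∈ B^{U}(1, δ)` then `‖z - 1‖ ≤ K·δ` and `‖V - 1‖ ≤ (1 + K)·δ`,
`K` the Lipschitz constant of `det`. [folklore] -/
theorem of_psi_mem_gball {K : ℝ} (hK0 : 0 ≤ K) (hK : ∀ U W : 𝔾 N,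
      ‖(U : Matrix (Fin N) (Fin N) ℂ).det - (W : Matrix (Fin N) (Fin N) ℂ).det‖ ≤
        K * ‖(U : Matrix (Fin N) (Fin N) ℂ) - W‖)
    {δ : ℝ} {z : Circle} {V : Matrix.specialUnitaryGroup (Fin N) ℂ} (h : psi (z, V) ∈ gball N δ) :
    ‖(z : ℂ) - 1‖ ≤ K * δ ∧ ‖(V : Matrix (Fin N) (Fin N) ℂ) - 1‖ ≤ (1 + K) * δ := by
  rw [mem_gball] at h
  have hz : ‖(z : ℂ) - 1‖ ≤ K * δ := by
    have h1 := hK (psi (z, V)) 1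
    rw [det_coe_psi, OneMemClass.coe_one, Matrix.det_one] at h1
    exact h1.trans (mul_le_mul_of_nonneg_left h hK0)
  refine ⟨hz, ?_⟩
  have e : (V : Matrix (Fin N) (Fin N) ℂ) - 1 =
      (((dC z)⁻¹ : 𝔾 N) : Matrix (Fin N) (Fin N) ℂ) *
        ((dmat (z : ℂ) * (V : Matrix (Fin N) (Fin N) ℂ) - 1) + (1 - dmat (z : ℂ))) := by
    have hinv : (((dC z)⁻¹ : 𝔾 N) : Matrix (Fin N) (Fin N) ℂ) * dmat (z : ℂ) = 1 := by
      rw [← coe_dC, ← Submonoid.coe_mul, inv_mul_cancel]; rfl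
    rw [sub_add_sub_cancel, Matrix.mul_sub, ← Matrix.mul_assoc, hinv, Matrix.one_mul]
  rw [e, Matrix.frobenius_norm_unitaryGroup_mul]
  calc _ ≤ ‖dmat (z : ℂ) * (V : Matrix (Fin N) (Fin N) ℂ) - 1‖ +
        ‖(1 : Matrix (Fin N) (Fin N) ℂ) - dmat (z : ℂ)‖ :=
        norm_add_le _ _
    _ ≤ δ + K * δ := by
        refine add_le_add h ?_
        rw [norm_sub_rev, ← coe_dC, norm_coe_dC_sub_one]; exact hz
    _ = (1 + K) * δ := by ring

end Balls

/-! ## §5. The Haar volume of the action balls of `SU(N)` is `≍ r^{N²-1}` -/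

section Bounds

variable [NeZero N]

/-- `N² = (N² - 1) + 1` in `ℕ` (`N ≥ 1`). [folklore] -/
theorem sq_eq_succ : N * N = (N * N - 1) + 1 :=
  (Nat.sub_add_cancel (Nat.one_le_iff_ne_zero.2 (mul_ne_zero (NeZero.ne N) (NeZero.ne N)))).symm

/-- `r^{N²-1}` as a real power is the monoid power (`N ≥ 1`). [folklore] -/
theorem rpow_sq_sub_one (r : ℝ) : r ^ ((N : ℝ) ^ 2 - 1) = r ^ (N * N - 1) := by
  have h1 : 1 ≤ N * N := Nat.one_le_iff_ne_zero.2 (mul_ne_zero (NeZero.ne N) (NeZero.ne N))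
  rw [← Real.rpow_natCast r (N * N - 1), Nat.cast_sub h1, Nat.cast_mul, Nat.cast_one, sq]

/-- **Upper volume bound for `r ≤ 1`**: `Haar(A_r) ≤ π·A·(1+√2)^{N²}·r^{N²-1}`, from
`Haar_{U(1)}(arc_r)·Haar(A_r) ≤ σ(B(1,(1+√2)r))`, `Haar_{U(1)}(arc_r) ≥ r/π`. [folklore] -/
theorem haar_actionBall_le_of_le_one : ∃ A : ℝ, 0 < A ∧ ∀ r : ℝ, 0 < r → r ≤ 1 →
    ((haarProbability (Matrix.specialUnitaryGroup (Fin N) ℂ))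
        {V | (N : ℝ) - (fundamentalRep (Fin N) V).trace.re ≤ r ^ 2}).toReal ≤ A * r ^ (N * N - 1) := by
  obtain ⟨A, hA, hvol⟩ := UN.haar_gball_le (N := N)
  have hπ := Real.pi_pos
  refine ⟨π * A * (1 + Real.sqrt 2) ^ (N * N), by positivity, fun r hr hr1 => ?_⟩
  have hsub : U1.arc r ×ˢ {V : Matrix.specialUnitaryGroup (Fin N) ℂ |
      (N : ℝ) - (fundamentalRep (Fin N) V).trace.re ≤ r ^ 2} ⊆ psi ⁻¹' gball N ((1 + Real.sqrt 2) * r) := by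
    rintro ⟨z, V⟩ ⟨hz, hV⟩
    rw [actionBall_eq hr.le, mem_setOf_eq] at hV
    rw [mem_preimage, show (1 + Real.sqrt 2) * r = r + Real.sqrt 2 * r by ring]
    exact psi_mem_gball hz hV
  have h1 : haarProbability Circle (U1.arc r) * haarProbability (Matrix.specialUnitaryGroup (Fin N) ℂ)
      {V | (N : ℝ) - (fundamentalRep (Fin N) V).trace.re ≤ r ^ 2} ≤
        haarProbability (𝔾 N) (gball N ((1 + Real.sqrt 2) * r)) := by
    rw [← Measure.prod_prod, haar_eq_prod_preimage (measurableSet_gball _)]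
    exact measure_mono hsub
  have h2 := ENNReal.toReal_mono (measure_ne_top _ _) h1
  rw [ENNReal.toReal_mul] at h2
  have h3 := hvol ((1 + Real.sqrt 2) * r) (by positivity)
  have harc := U1.haar_arc_ge hr hr1
  rw [Real.rpow_one] at harc
  have hm0 : 0 ≤ ((haarProbability (Matrix.specialUnitaryGroup (Fin N) ℂ))
      {V | (N : ℝ) - (fundamentalRep (Fin N) V).trace.re ≤ r ^ 2}).toReal := ENNReal.toReal_nonneg
  have h4 : 1 / π * r * ((haarProbability (Matrix.specialUnitaryGroup (Fin N) ℂ))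
      {V | (N : ℝ) - (fundamentalRep (Fin N) V).trace.re ≤ r ^ 2}).toReal ≤
        A * (1 + Real.sqrt 2) ^ (N * N) * (r ^ (N * N - 1) * r) := by
    calc _ ≤ (haarProbability Circle (U1.arc r)).toReal *
          ((haarProbability (Matrix.specialUnitaryGroup (Fin N) ℂ))
            {V | (N : ℝ) - (fundamentalRep (Fin N) V).trace.re ≤ r ^ 2}).toReal :=
          mul_le_mul_of_nonneg_right harc hm0
      _ ≤ A * ((1 + Real.sqrt 2) * r) ^ (N * N) := h2.trans h3
      _ = _ := by rw [mul_pow, ← pow_succ, ← sq_eq_succ]; ring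
  have h5 : r * ((haarProbability (Matrix.specialUnitaryGroup (Fin N) ℂ))
      {V | (N : ℝ) - (fundamentalRep (Fin N) V).trace.re ≤ r ^ 2}).toReal ≤
        r * (π * A * (1 + Real.sqrt 2) ^ (N * N) * r ^ (N * N - 1)) := by
    have h6 := mul_le_mul_of_nonneg_left h4 hπ.le
    have e1 : π * (1 / π * r * ((haarProbability (Matrix.specialUnitaryGroup (Fin N) ℂ))
        {V | (N : ℝ) - (fundamentalRep (Fin N) V).trace.re ≤ r ^ 2}).toReal) =
        r * ((haarProbability (Matrix.specialUnitaryGroup (Fin N) ℂ))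
          {V | (N : ℝ) - (fundamentalRep (Fin N) V).trace.re ≤ r ^ 2}).toReal := by
      field_simp
    have e2 : π * (A * (1 + Real.sqrt 2) ^ (N * N) * (r ^ (N * N - 1) * r)) =
        r * (π * A * (1 + Real.sqrt 2) ^ (N * N) * r ^ (N * N - 1)) := by ring
    rw [e1, e2] at h6
    exact h6
  exact le_of_mul_le_mul_left h5 hr

/-- **UPPER VOLUME BOUND** (`N ≥ 1`, all `r > 0`): `Haar{V ∈ SU(N) : N - Re tr V ≤ r²} ≤ A·r^{N²-1}` —
the literal form of theory-2's item `SUN.HaarActionBallUpper N`. [folklore] -/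
theorem haar_actionBall_le : ∃ A : ℝ, ∀ r : ℝ, 0 < r →
    ((haarProbability (Matrix.specialUnitaryGroup (Fin N) ℂ))
        {U | (N : ℝ) - (fundamentalRep (Fin N) U).trace.re ≤ r ^ 2}).toReal ≤ A * r ^ ((N : ℝ) ^ 2 - 1) := by
  obtain ⟨A, hA, h⟩ := haar_actionBall_le_of_le_one (N := N)
  refine ⟨A + 1, fun r hr => ?_⟩
  rw [rpow_sq_sub_one]
  by_cases hr1 : r ≤ 1
  · have := h r hr hr1
    nlinarith [pow_pos hr (N * N - 1)]
  · rw [not_le] at hr1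
    have h1 : ((haarProbability (Matrix.specialUnitaryGroup (Fin N) ℂ))
        {U | (N : ℝ) - (fundamentalRep (Fin N) U).trace.re ≤ r ^ 2}).toReal ≤ 1 :=
      ENNReal.toReal_le_of_le_ofReal zero_le_one (by rw [ENNReal.ofReal_one]; exact prob_le_one)
    have h2 : (1 : ℝ) ≤ r ^ (N * N - 1) := one_le_pow₀ hr1.le
    nlinarith

/-- **LOWER VOLUME BOUND** (`N ≥ 1`, `0 < r ≤ 1`): `a·r^{N²-1} ≤ Haar{V ∈ SU(N) : N - Re tr V ≤ r²}` —
the literal form of theory-2's item `SUN.HaarActionBallLower N`.  With `δ = √2·r/(1+K)`: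
`a_U·δ^{N²} ≤ σ(B(1,δ)) ≤ Haar_{U(1)}{‖z-1‖ ≤ Kδ}·Haar(A_r) ≤ (Kδ/2)·Haar(A_r)`. [folklore] -/
theorem haar_actionBall_ge : ∃ a : ℝ, 0 < a ∧ ∀ r : ℝ, 0 < r → r ≤ 1 →
    a * r ^ ((N : ℝ) ^ 2 - 1) ≤
      ((haarProbability (Matrix.specialUnitaryGroup (Fin N) ℂ))
        {U | (N : ℝ) - (fundamentalRep (Fin N) U).trace.re ≤ r ^ 2}).toReal := by
  obtain ⟨a, ha, hvol⟩ := UN.haar_gball_ge (N := N)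
  obtain ⟨K, hK1, hK⟩ := exists_det_lipschitz (N := N)
  have hK0 : 0 < K := by linarith
  have hs0 : 0 ≤ Real.sqrt 2 := Real.sqrt_nonneg 2
  have hs2 : Real.sqrt 2 < 3 / 2 := by
    rw [Real.sqrt_lt' (by norm_num)]; norm_num
  set c : ℝ := Real.sqrt 2 / (1 + K) with hc
  have hc0 : 0 < c := by positivity
  have hc1 : c ≤ 1 := by rw [hc, div_le_one (by positivity)]; linarith
  refine ⟨2 * a / K * c ^ (N * N - 1), by positivity, fun r hr hr1 => ?_⟩
  set δ : ℝ := c * r with hδ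
  have hδ0 : 0 < δ := by positivity
  have hδ1 : δ ≤ 1 := by rw [hδ]; nlinarith
  have hKδ : (1 + K) * δ = Real.sqrt 2 * r := by rw [hδ, hc]; field_simp
  have hKδ2 : K * δ < 2 := by nlinarith
  have hsub : psi ⁻¹' gball N δ ⊆ {z : Circle | ‖(z : ℂ) - 1‖ ≤ K * δ} ×ˢ
      {V : Matrix.specialUnitaryGroup (Fin N) ℂ | (N : ℝ) - (fundamentalRep (Fin N) V).trace.re ≤ r ^ 2} := by
    rintro ⟨z, V⟩ h
    rw [mem_preimage] at h
    obtain ⟨hz, hV⟩ := of_psi_mem_gball hK0.le hK h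
    refine ⟨hz, ?_⟩
    rw [actionBall_eq hr.le, mem_setOf_eq, ← hKδ]
    exact hV
  have h1 : haarProbability (𝔾 N) (gball N δ) ≤
      haarProbability Circle {z : Circle | ‖(z : ℂ) - 1‖ ≤ K * δ} *
      haarProbability (Matrix.specialUnitaryGroup (Fin N) ℂ)
        {V | (N : ℝ) - (fundamentalRep (Fin N) V).trace.re ≤ r ^ 2} := by
    rw [haar_eq_prod_preimage (measurableSet_gball _), ← Measure.prod_prod]
    exact measure_mono hsub
  have h2 := ENNReal.toReal_mono (ENNReal.mul_ne_top (measure_ne_top _ _) (measure_ne_top _ _)) h1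
  rw [ENNReal.toReal_mul] at h2
  have h3 := hvol δ hδ0 hδ1
  have h4 := haar_chordBall_le (t := K * δ) (by positivity) hKδ2
  have hm0 : 0 ≤ ((haarProbability (Matrix.specialUnitaryGroup (Fin N) ℂ))
      {V | (N : ℝ) - (fundamentalRep (Fin N) V).trace.re ≤ r ^ 2}).toReal := ENNReal.toReal_nonneg
  have h5 : a * (δ ^ (N * N - 1) * δ) ≤ K * δ / 2 * ((haarProbability (Matrix.specialUnitaryGroup (Fin N) ℂ))
      {V | (N : ℝ) - (fundamentalRep (Fin N) V).trace.re ≤ r ^ 2}).toReal := by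
    rw [← pow_succ, ← sq_eq_succ]
    exact h3.trans (h2.trans (mul_le_mul_of_nonneg_right h4 hm0))
  rw [rpow_sq_sub_one]
  have h6 : δ * (2 * a / K * δ ^ (N * N - 1)) ≤ δ * ((haarProbability (Matrix.specialUnitaryGroup (Fin N) ℂ))
      {V | (N : ℝ) - (fundamentalRep (Fin N) V).trace.re ≤ r ^ 2}).toReal := by
    have e1 : δ * (2 * a / K * δ ^ (N * N - 1)) = 2 / K * (a * (δ ^ (N * N - 1) * δ)) := by
      field_simp
    have e2 : 2 / K * (K * δ / 2 * ((haarProbability (Matrix.specialUnitaryGroup (Fin N) ℂ))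
        {V | (N : ℝ) - (fundamentalRep (Fin N) V).trace.re ≤ r ^ 2}).toReal) =
        δ * ((haarProbability (Matrix.specialUnitaryGroup (Fin N) ℂ))
          {V | (N : ℝ) - (fundamentalRep (Fin N) V).trace.re ≤ r ^ 2}).toReal := by
      field_simp
    rw [e1, ← e2]
    exact mul_le_mul_of_nonneg_left h5 (by positivity)
  have h7 := le_of_mul_le_mul_left h6 hδ0
  calc 2 * a / K * c ^ (N * N - 1) * r ^ (N * N - 1) = 2 * a / K * δ ^ (N * N - 1) := by
        rw [hδ, mul_pow]; ring
    _ ≤ _ := h7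

end Bounds

end Summit.Ventures.LatticeQCDFlow.Theory2.Lattice.SUNHaar

end
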